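import Summits.QuantumFields.YangMills.Theorems.FemtoTransferGapBounds
import Summits.QuantumFields.YangMills.Theorems.FemtoTransferGapLevelsPos

/-!
# Femto transfer gap — THE CUTOFF LADDER (dyadic telescoping): one-sided uniform octave step + coarse pairs to `L' = 1` + one-site anchor
# + deep-window matching ⟹ the rung leaf `FemtoGapOfRecord` (route-independent core of the Assembly of route `FemtoCutoffLadder`)

Lead seat `ym-line-fcl-p1` (2026-08-27), for the Assembly item stmt-QuantumFields-23510 of route `FemtoCutoffLadder` (rung R2b1).  This module
imports NO `Theses` file: its hypotheses are spelled-out texts — exactly the halves of the route's items that the telescoping consumes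
(critic idea-crit-4, price P1: only the FIRST conjuncts «the femto gap does not decrease under refinement, up to the slack» and only the
coarse pairs `(L, 1)` are load-bearing) — and its conclusion is the tree leaf `FemtoTransferGap.FemtoGapOfRecord` by name.  The closer file
`FemtoCutoffLadderAssembly.lean` feeds the route's items into it.

THE ARGUMENT (strong induction on the lattice size, potential `w(L) = L^{−σ}`).  Write `a_L = λ₁(β,L)^L`, `b_L = λ₀(β,L)^L` for a window
point `(β, L)` of depth `lam` and `Λ = Λ(β, L)`; matched partners share `Λ` (hypothesis `hM`, depth `lam ≤ 1/2`).
* Base (`L < N := 2L₀ + 2`): coarse pair `(L, 1)` — `a_L b'_1 ≤ e^{C_L Λ²} a'_1 b_L` — and the anchor `a'_1 ≤ e^{−ε₁Λ + C_a Λ²} b'_1` give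
  `a_L ≤ e^{−ε₁Λ + (C_L + C_a)Λ²} b_L`; `C_L ≤ M := Σ_{L<N} |C_L|`.
* Step (`L ≥ N`, `L' = ⌈L/2⌉ ≥ L₀`, `L' < L`, `4L' ≤ 3L`): the octave step `a_L b_{L'} ≤ e^{CΛ²/L'^σ} a_{L'} b_L` and the induction
  hypothesis at `L'`; the slack is absorbed by the potential: with `q = (3/4)^σ < 1`, `κ = 1 − q`, `w(L) ≤ q·w(L')`, so
  `C⁺ w(L') + (C⁺/κ)(1 − w(L')) ≤ (C⁺/κ)(1 − w(L))` — the bound `a_L ≤ e^{−ε₁Λ + F(L)Λ²} b_L`, `F(L) = |C_a| + M + (C⁺/κ)(1 − w(L))`,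
  propagates, and `F(L) ≤ C_tot := |C_a| + M + C⁺/κ` uniformly in `L`.
* `L`-th roots (`λ₀ > 0`, `λ₁ > 0`: tree `topValue_su2Rep_pos`, `secondValue_su2Rep_pos`): `λ₁ ≤ e^{−(ε₁Λ − C_tot Λ²)/L} λ₀`, every `L ≥ 1`,
  every window point of depth `lam ≤ lam0 := min(lam_S, lam_A, min_{L<N} lam_L, 1/2)` — i.e. `FemtoGapOfRecord` with `L₀(lam) = 0`.

★ `femtoGapOfRecord_of_ladder` (§3).  §1: real-number lemmas (combination of a pair bound with a one-lattice bound; potential bookkeeping);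
§2: the induction.

HONEST FRAMING: pure bookkeeping (real analysis over the tree's positivity lemmas); the mathematics of the route is in its two cruxes
(`UniformStepScaling`, `CoarsePairScaling`), which are OPEN.  Femto rung R2b1 is a RECORD rung: nothing here is infinite volume, a mass gap
or the Clay problem.  No definitions, no named facts, no `sorry`.
-/

set_option autoImplicit false

noncomputable section

namespace Summit.QuantumFields.YangMills.Theorems.FemtoTransferGap.CutoffLadder

open Real
open Summit.QuantumFields.YangMills.Theorems.FemtoTransferGap
open Literature.Analysis.OperatorTheory.YMMatrixModel (luscherEps1)

/-! ## §1 Real-number lemmas -/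

/-- Combination step: a cross-multiplied pair bound `a·b' ≤ e^{E₁}·(a'·b)` and a one-lattice bound `a' ≤ e^{E₂}·b'` (`b' > 0`, `b ≥ 0`)
give `a ≤ e^{E₁+E₂}·b`. [folklore] -/
theorem le_of_pair_of_partner {a b a' b' E₁ E₂ : ℝ} (hb' : 0 < b') (hb : 0 ≤ b)
    (h1 : a * b' ≤ Real.exp E₁ * (a' * b)) (h2 : a' ≤ Real.exp E₂ * b') :
    a ≤ Real.exp (E₁ + E₂) * b := by
  have h3 : Real.exp E₁ * (a' * b) ≤ Real.exp E₁ * (Real.exp E₂ * b' * b) :=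
    mul_le_mul_of_nonneg_left (mul_le_mul_of_nonneg_right h2 hb) (Real.exp_pos E₁).le
  have h4 : a * b' ≤ (Real.exp (E₁ + E₂) * b) * b' := by
    calc a * b' ≤ Real.exp E₁ * (Real.exp E₂ * b' * b) := h1.trans h3
      _ = (Real.exp (E₁ + E₂) * b) * b' := by rw [Real.exp_add]; ring
  exact le_of_mul_le_mul_right h4 hb'

/-- Exponent monotonicity with a nonnegative factor. [folklore] -/
theorem exp_mul_le_exp_mul {E E' b : ℝ} (hE : E ≤ E') (hb : 0 ≤ b) : Real.exp E * b ≤ Real.exp E' * b :=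
  mul_le_mul_of_nonneg_right (Real.exp_le_exp.mpr hE) hb

/-- The potential `w(L) = (L^σ)⁻¹` lies in `[0, 1]` for `L ≥ 1`, `σ ≥ 0`. [folklore] -/
theorem potential_le_one {σ : ℝ} (hσ : 0 ≤ σ) (L : ℕ) [NeZero L] : ((L : ℝ) ^ σ)⁻¹ ≤ 1 := by
  have hL1 : (1 : ℝ) ≤ (L : ℝ) := by exact_mod_cast NeZero.one_le
  exact inv_le_one_of_one_le₀ (Real.one_le_rpow hL1 hσ)

/-- Contraction of the potential over one octave: `4L' ≤ 3L` gives `w(L) ≤ (3/4)^σ · w(L')`. [folklore] -/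
theorem potential_contract {σ : ℝ} (hσ : 0 ≤ σ) {L L' : ℕ} (hL' : 0 < L') (h43 : 4 * L' ≤ 3 * L) :
    ((L : ℝ) ^ σ)⁻¹ ≤ (3 / 4 : ℝ) ^ σ * ((L' : ℝ) ^ σ)⁻¹ := by
  have hL'r : (0 : ℝ) < L' := by exact_mod_cast hL'
  have h43r : (4 : ℝ) * L' ≤ 3 * L := by exact_mod_cast h43
  have hLr : (0 : ℝ) < L := by linarith
  have hq : (3 / 4 : ℝ) ^ σ = ((4 / 3 : ℝ) ^ σ)⁻¹ := by
    rw [← Real.inv_rpow (by norm_num : (0 : ℝ) ≤ 4 / 3)]; norm_num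
  rw [hq, ← mul_inv, ← Real.mul_rpow (by norm_num) hL'r.le]
  have hpos : 0 < ((4 / 3 : ℝ) * L') ^ σ := Real.rpow_pos_of_pos (by positivity) σ
  apply (inv_le_inv₀ (Real.rpow_pos_of_pos hLr σ) hpos).mpr
  exact Real.rpow_le_rpow (by positivity) (by linarith) hσ

/-- Potential bookkeeping of the induction step: with `0 ≤ C ≤ C⁺`, `0 < κ`, `q = 1 − κ`, `0 ≤ w'`, `w ≤ q w'`:
`C w' + (C⁺/κ)(1 − w') ≤ (C⁺/κ)(1 − w)` (for `C ≤ C⁺`, `0 ≤ C⁺`). [folklore] -/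
theorem step_budget {C Cp κ q w w' : ℝ} (hC : C ≤ Cp) (hCp : 0 ≤ Cp) (hκ : 0 < κ) (hq : q = 1 - κ) (hw' : 0 ≤ w')
    (hw : w ≤ q * w') : C * w' + Cp / κ * (1 - w') ≤ Cp / κ * (1 - w) := by
  have h1 : C * w' ≤ Cp * w' := mul_le_mul_of_nonneg_right hC hw'
  have h2 : Cp / κ * (1 - w) - (Cp * w' + Cp / κ * (1 - w')) = Cp / κ * (q * w' - w) := by
    rw [hq]; field_simp; ring
  have h3 : 0 ≤ Cp / κ * (q * w' - w) := mul_nonneg (div_nonneg hCp hκ.le) (by linarith)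
  linarith

/-- Taking `L`-th roots: `λ₁^L ≤ e^{−z}·λ₀^L` with `λ₁ ≥ 0`, `λ₀ ≥ 0`, `L ≥ 1` gives `λ₁ ≤ e^{−z/L}·λ₀`. [folklore] -/
theorem root_of_pow_le {x y z : ℝ} {L : ℕ} [NeZero L] (hx : 0 ≤ x) (hy : 0 ≤ y)
    (h : x ^ L ≤ Real.exp (-z) * y ^ L) : x ≤ Real.exp (-z / L) * y := by
  have hL : (L : ℝ) ≠ 0 := by exact_mod_cast NeZero.ne L
  have hE : Real.exp (-z) = Real.exp (-z / L) ^ L := by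
    rw [← Real.exp_nat_mul, mul_div_cancel₀ _ hL]
  rw [hE, ← mul_pow] at h
  exact (pow_le_pow_iff_left₀ hx (mul_nonneg (Real.exp_pos _).le hy) (NeZero.ne L)).mp h

/-! ## §2–§3 The ladder -/

/-- ★ **THE CUTOFF LADDER.**  From (hS) the one-sided UNIFORM OCTAVE STEP above an absolute `L₀` with slack `e^{CΛ²/L'^σ}`, (hP) the
one-sided COARSE PAIRS `(L, 1)` with slack `e^{C_L Λ²}`, (hA) the ONE-SITE ANCHOR in window form and (hM) DEEP-WINDOW MATCHING
(`lam ≤ 1/2`), the rung leaf `FemtoGapOfRecord` follows by dyadic telescoping (strong induction on `L`, potential `L^{−σ}`, geometric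
absorption of the step slacks, finitely many coarse constants below `2L₀ + 2`, `L`-th roots by positivity of `λ₀`, `λ₁`).
Output constants: `C = |C_a| + Σ_{L<2L₀+2}|C_L| + max(C,0)/(1 − (3/4)^σ)`, `lam0 = min(lam_S, lam_A, min_L lam_L, 1/2)`, `L₀(lam) = 0`.
[cite: LuscherWeiszWolff1991] [cite: LuscherMunster1984, §2] -/
theorem femtoGapOfRecord_of_ladder
    (hS : ∃ (C σ lam0 : ℝ) (L0 : ℕ), 0 < σ ∧ 0 < lam0 ∧ ∀ lam : ℝ, 0 < lam → lam ≤ lam0 →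
      ∀ (L' : ℕ) [NeZero L'] (L : ℕ) [NeZero L], L0 ≤ L' → L' ≤ L → L ≤ 2 * L' →
        ∀ β β' : ℝ, InFemtoWindow lam β L → InFemtoWindow lam β' L' → luscherLambda β L = luscherLambda β' L' →
          secondValue su2Rep L β ^ L * topValue su2Rep L' β' ^ L' ≤
            Real.exp (C * luscherLambda β L ^ 2 / (L' : ℝ) ^ σ) * (secondValue su2Rep L' β' ^ L' * topValue su2Rep L β ^ L))
    (hP : ∀ (L : ℕ) [NeZero L], ∃ C lam0 : ℝ, 0 < lam0 ∧ ∀ lam : ℝ, 0 < lam → lam ≤ lam0 →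
      ∀ β β' : ℝ, InFemtoWindow lam β L → InFemtoWindow lam β' 1 → luscherLambda β L = luscherLambda β' 1 →
        secondValue su2Rep L β ^ L * topValue su2Rep 1 β' ^ 1 ≤
          Real.exp (C * luscherLambda β L ^ 2) * (secondValue su2Rep 1 β' ^ 1 * topValue su2Rep L β ^ L))
    (hA : ∃ C lam0 : ℝ, 0 < lam0 ∧ ∀ lam : ℝ, 0 < lam → lam ≤ lam0 → ∀ β : ℝ, InFemtoWindow lam β 1 →
      secondValue su2Rep 1 β ≤ Real.exp (-(zLower C β 1)) * topValue su2Rep 1 β)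
    (hM : ∀ lam : ℝ, 0 < lam → lam ≤ 1 / 2 → ∀ (L : ℕ) [NeZero L] (L' : ℕ) [NeZero L'] (β : ℝ),
      InFemtoWindow lam β L → ∃ β' : ℝ, InFemtoWindow lam β' L' ∧ luscherLambda β' L' = luscherLambda β L) :
    FemtoGapOfRecord := by
  obtain ⟨Cs, σ, lamS, L0s, hσ, hlamS, HS⟩ := hS
  obtain ⟨Ca, lamA, hlamA, HA⟩ := hA
  choose Cp lamP hlamP HP using fun n : ℕ => hP (n + 1)
  -- the threshold below which coarse pairs are used, and the merged constants
  set N : ℕ := 2 * L0s + 2 with hN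
  have hNpos : 0 < N := by omega
  have hne : (Finset.range N).Nonempty := ⟨0, Finset.mem_range.mpr hNpos⟩
  set Csp : ℝ := max Cs 0 with hCsp
  have hCsp0 : 0 ≤ Csp := le_max_right _ _
  have hCsle : Cs ≤ Csp := le_max_left _ _
  set q : ℝ := (3 / 4 : ℝ) ^ σ with hq_def
  have hq1 : q < 1 := Real.rpow_lt_one (by norm_num) (by norm_num) hσ
  set κ : ℝ := 1 - q with hκ_def
  have hκ : 0 < κ := by rw [hκ_def]; linarith
  have hqκ : q = 1 - κ := by rw [hκ_def]; ring
  set M : ℝ := ∑ n ∈ Finset.range N, |Cp n| with hM_def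
  set Ctot : ℝ := |Ca| + M + Csp / κ with hCtot
  set lamPmin : ℝ := (Finset.range N).inf' hne lamP with hlamPmin_def
  have hlamPmin : 0 < lamPmin := (Finset.lt_inf'_iff hne).mpr fun n _ => hlamP n
  -- the potential and the running constant of the induction
  let w : ℕ → ℝ := fun m => (((m : ℕ) : ℝ) ^ σ)⁻¹
  let F : ℕ → ℝ := fun m => |Ca| + M + Csp / κ * (1 - w m)
  have hw0 : ∀ m : ℕ, 0 ≤ w m := fun m => inv_nonneg.mpr (Real.rpow_nonneg (Nat.cast_nonneg m) σ)
  have hw1 : ∀ m : ℕ, 0 < m → w m ≤ 1 := fun m hm => by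
    haveI : NeZero m := ⟨Nat.pos_iff_ne_zero.mp hm⟩
    exact potential_le_one hσ.le m
  have hFle : ∀ m : ℕ, F m ≤ Ctot := fun m => by
    have : Csp / κ * (1 - w m) ≤ Csp / κ := by
      have h := hw0 m
      have hck : 0 ≤ Csp / κ := div_nonneg hCsp0 hκ.le
      nlinarith
    show |Ca| + M + Csp / κ * (1 - w m) ≤ |Ca| + M + Csp / κ
    linarith
  have hFge : ∀ m : ℕ, 0 < m → |Ca| + M ≤ F m := fun m hm => by
    have : 0 ≤ Csp / κ * (1 - w m) := mul_nonneg (div_nonneg hCsp0 hκ.le) (by linarith [hw1 m hm])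
    show |Ca| + M ≤ |Ca| + M + Csp / κ * (1 - w m)
    linarith
  refine ⟨Ctot, min (min lamS lamA) (min lamPmin (1 / 2)), lt_min (lt_min hlamS hlamA) (lt_min hlamPmin (by norm_num)), ?_⟩
  intro lam hlam hle
  have hleS : lam ≤ lamS := hle.trans ((min_le_left _ _).trans (min_le_left _ _))
  have hleA : lam ≤ lamA := hle.trans ((min_le_left _ _).trans (min_le_right _ _))
  have hleP : lam ≤ lamPmin := hle.trans ((min_le_right _ _).trans (min_le_left _ _))
  have hhalf : lam ≤ 1 / 2 := hle.trans ((min_le_right _ _).trans (min_le_right _ _))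
  -- ### the induction: for every `n`, every window point on the lattice `n + 1`
  have claim : ∀ n : ℕ, ∀ β : ℝ, InFemtoWindow lam β (n + 1) →
      secondValue su2Rep (n + 1) β ^ (n + 1) ≤
        Real.exp (-(luscherEps1 * luscherLambda β (n + 1)) + F (n + 1) * luscherLambda β (n + 1) ^ 2) *
          topValue su2Rep (n + 1) β ^ (n + 1) := by
    intro n
    induction n using Nat.strong_induction_on with
    | _ n ih =>
      intro β hW
      set Λ : ℝ := luscherLambda β (n + 1) with hΛ
      have hb : 0 ≤ topValue su2Rep (n + 1) β ^ (n + 1) := pow_nonneg (topValue_su2Rep_pos (n + 1) β).le _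
      by_cases hn : n + 1 < N
      · -- BASE: coarse pair `(n+1, 1)` and the anchor
        have hnr : n ∈ Finset.range N := Finset.mem_range.mpr (by omega)
        have hleP' : lam ≤ lamP n := hleP.trans (Finset.inf'_le lamP hnr)
        obtain ⟨β', hW', hmatch⟩ := hM lam hlam hhalf (n + 1) 1 β hW
        have h1 := HP n lam hlam hleP' β β' hW hW' hmatch.symm
        simp only [pow_one] at h1
        have h2 := HA lam hlam hleA β' hW'
        have hb' : 0 < topValue su2Rep 1 β' := topValue_su2Rep_pos 1 β'
        have h3 := le_of_pair_of_partner hb' hb h1 h2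
        refine h3.trans (exp_mul_le_exp_mul ?_ hb)
        have hz : zLower Ca β' 1 = luscherEps1 * Λ - Ca * Λ ^ 2 := by
          show luscherEps1 * luscherLambda β' 1 - Ca * luscherLambda β' 1 ^ 2 = _
          rw [hmatch]
        rw [hz]
        have hCpM : Cp n ≤ M := (le_abs_self _).trans (Finset.single_le_sum (fun m _ => abs_nonneg (Cp m)) hnr)
        have hCa : Ca ≤ |Ca| := le_abs_self _
        have hF := hFge (n + 1) (Nat.succ_pos n)
        nlinarith [sq_nonneg Λ]
      · -- STEP: octave `(n'+1, n+1)`, `n' = n / 2`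
        push Not at hn
        set n' : ℕ := n / 2 with hn'
        have hlt : n' < n := by omega
        have hL0 : L0s ≤ n' + 1 := by omega
        have hle1 : n' + 1 ≤ n + 1 := by omega
        have hle2 : n + 1 ≤ 2 * (n' + 1) := by omega
        have h43 : 4 * (n' + 1) ≤ 3 * (n + 1) := by omega
        obtain ⟨β', hW', hmatch⟩ := hM lam hlam hhalf (n + 1) (n' + 1) β hW
        have h1 := HS lam hlam hleS (n' + 1) (n + 1) hL0 hle1 hle2 β β' hW hW' hmatch.symm
        have h2 := ih n' hlt β' hW'
        have hb' : 0 < topValue su2Rep (n' + 1) β' ^ (n' + 1) := pow_pos (topValue_su2Rep_pos (n' + 1) β') _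
        have h3 := le_of_pair_of_partner hb' hb h1 h2
        refine h3.trans (exp_mul_le_exp_mul ?_ hb)
        rw [hmatch]
        -- the slack `Cs Λ²/L'^σ = (Cs · w L') Λ²` and the budget
        have hslack : Cs * Λ ^ 2 / (((n' + 1 : ℕ) : ℝ)) ^ σ = Cs * w (n' + 1) * Λ ^ 2 := by
          show Cs * Λ ^ 2 / (((n' + 1 : ℕ) : ℝ)) ^ σ = Cs * ((((n' + 1 : ℕ) : ℝ)) ^ σ)⁻¹ * Λ ^ 2
          ring
        rw [hslack]
        have hcontr : w (n + 1) ≤ q * w (n' + 1) :=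
          potential_contract hσ.le (Nat.succ_pos n') h43
        have hbudget := step_budget hCsle hCsp0 hκ hqκ (hw0 (n' + 1)) hcontr
        have hFn : F (n + 1) = |Ca| + M + Csp / κ * (1 - w (n + 1)) := rfl
        have hFn' : F (n' + 1) = |Ca| + M + Csp / κ * (1 - w (n' + 1)) := rfl
        rw [hFn, hFn']
        nlinarith [sq_nonneg Λ]
  -- ### conclusion: `L`-th roots, `L₀(lam) = 0`
  refine ⟨0, ?_⟩
  intro L _ _ β hW
  obtain ⟨n, rfl⟩ : ∃ n, L = n + 1 := Nat.exists_eq_succ_of_ne_zero (NeZero.ne L)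
  have h := claim n β hW
  have hb : 0 ≤ topValue su2Rep (n + 1) β ^ (n + 1) := pow_nonneg (topValue_su2Rep_pos (n + 1) β).le _
  have h' : secondValue su2Rep (n + 1) β ^ (n + 1) ≤
      Real.exp (-(zLower Ctot β (n + 1))) * topValue su2Rep (n + 1) β ^ (n + 1) := by
    refine h.trans (exp_mul_le_exp_mul ?_ hb)
    show -(luscherEps1 * luscherLambda β (n + 1)) + F (n + 1) * luscherLambda β (n + 1) ^ 2 ≤
      -(luscherEps1 * luscherLambda β (n + 1) - Ctot * luscherLambda β (n + 1) ^ 2)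
    nlinarith [hFle (n + 1), sq_nonneg (luscherLambda β (n + 1))]
  exact root_of_pow_le (secondValue_su2Rep_pos (by linarith [hW.1])).le (topValue_su2Rep_pos (n + 1) β).le h'

end Summit.QuantumFields.YangMills.Theorems.FemtoTransferGap.CutoffLadder

end
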